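import Summits.PneNP.PneNP.Theses.ChebyshevTracialDesign
import HarnessLib

/-!
# Route `ChebyshevTracialDesign`, item `StretchedExpAssembly`: hyperplane bound + cruxes ⇒ Target

The support item `Summit.PneNP.PneNP.Theses.ChebyshevTracialDesign.StretchedExpAssembly` says
`PsdHyperplaneBound → TracialDecay20 → ChebyshevDesign20 → Target`. Proof (the planner's
PLAN-StretchedExpAssembly.md, Rothvoß's §2 assembly in psd form):

1. the two cruxes compose into `ExpTracialBoundDim` by the tree lemma `expTracialBoundDim_of_bal`;
2. Rothvoß's double count [Rothvoß 2017, §2 eq. (2)]: for the multilevel planted weight `W` of a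
   normalised profile, `⟨W, S⟩ = Σ_c w_c (c - 1) = 1` where `S_{UM} = |δ(U) ∩ M| - 1` is the odd-cut slack
   matrix (`sum_levelWeight_mul_slack`);
3. a psd factorization of `S` of size `r = 0` forces `S = 0`, contradicting `⟨W,S⟩ = 1`; for `r ≥ 1` the
   hyperplane bound (`TracialHyperplaneBoundAt`, exponent `p`) with `Δ = n²` (`cc_sub_one_le`) and the
   tracial value bound `γ = n^{-a·dq n}` give `1 = ⟨W,S⟩ ≤ r^p n² n^{-a·dq n}`;
4. arithmetic (`key_arith`): with `c = a / (8(p+2))`, `r < exp(c·n^{1/4})`, `dq n ≥ n^{1/4}/2` and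
   `n ≥ (6/a)^4`, both `r²·n < n^{a·dq n}` and `r^p·n²·n^{-a·dq n} < 1` hold — contradiction.

Nothing beyond the route's own hypotheses is assumed; `δ = 1/4`.
-/

set_option linter.dupNamespace false -- `Summit.PneNP.PneNP.…`: summit = sub-problem (D-0017)

noncomputable section

open Finset Real
open Literature.Combinatorics.Optimization Literature.Barriers.PneNP

namespace Summit.PneNP.PneNP.Theorems

namespace ChebyshevTracialDesignAssembly

/-- **Rothvoß's double count**: `Σ_{U,M} W(U,M) · (|δ(U) ∩ M| - 1) = Σ_{c ∈ C} w_c (c - 1)` for the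
multilevel planted weight of a profile `w` on nonempty level classes.
[cite: Rothvoss2017, §2 (PDF p. 6, eq. (2))] -/
theorem sum_levelWeight_mul_slack {n t : ℕ} {C : Finset ℕ} {w : ℕ → ℝ}
    (hne : ∀ c ∈ C, (Qset n t c).Nonempty) :
    ∑ U, ∑ M, levelWeight n t C w U M * pmOddCutSlack n U M = ∑ c ∈ C, w c * ((c : ℝ) - 1) := by
  classical
  calc ∑ U, ∑ M, levelWeight n t C w U M * pmOddCutSlack n U M
      = ∑ U, ∑ M, ∑ c ∈ C,
          (if (U, M) ∈ Qset n t c then w c / ((Qset n t c).card : ℝ) * pmOddCutSlack n U M else 0) := by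
        refine sum_congr rfl fun U _ => sum_congr rfl fun M _ => ?_
        rw [levelWeight, sum_mul]
        exact sum_congr rfl fun c _ => by split_ifs <;> simp
    _ = ∑ U, ∑ c ∈ C, ∑ M,
          (if (U, M) ∈ Qset n t c then w c / ((Qset n t c).card : ℝ) * pmOddCutSlack n U M else 0) :=
        sum_congr rfl fun U _ => sum_comm
    _ = ∑ c ∈ C, ∑ U, ∑ M,
          (if (U, M) ∈ Qset n t c then w c / ((Qset n t c).card : ℝ) * pmOddCutSlack n U M else 0) :=
        sum_comm
    _ = ∑ c ∈ C, w c * ((c : ℝ) - 1) := by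
        refine sum_congr rfl fun c hc => ?_
        rw [sum_sum_ite_mem (Qset n t c) fun U M => w c / ((Qset n t c).card : ℝ) * pmOddCutSlack n U M]
        have hval : ∀ p ∈ Qset n t c, w c / ((Qset n t c).card : ℝ) * pmOddCutSlack n p.1 p.2 =
            w c / ((Qset n t c).card : ℝ) * ((c : ℝ) - 1) := by
          intro p hp
          rw [pmOddCutSlack, (mem_Qset_iff.1 hp).2]
        rw [sum_congr rfl hval, sum_const, nsmul_eq_mul]
        have hcard : ((Qset n t c).card : ℝ) ≠ 0 := by
          exact_mod_cast (card_pos.2 (hne c hc)).ne'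
        field_simp

/-- `n < (dq n + 1)⁴`. [cite: CoppersmithRivlin1992, Thm. (p. 970); elementary] -/
theorem lt_dq_succ_pow_four (n : ℕ) : n < (dq n + 1) ^ 4 := by
  have h1 : n < (Nat.sqrt n + 1) ^ 2 := by
    have := Nat.lt_succ_sqrt' n; simpa [sq] using this
  have h2 : Nat.sqrt n < (dq n + 1) ^ 2 := by
    have := Nat.lt_succ_sqrt' (Nat.sqrt n); rw [dq]; simpa [sq] using this
  have h3 : Nat.sqrt n + 1 ≤ (dq n + 1) ^ 2 := h2
  calc n < (Nat.sqrt n + 1) ^ 2 := h1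
    _ ≤ ((dq n + 1) ^ 2) ^ 2 := Nat.pow_le_pow_left h3 2
    _ = (dq n + 1) ^ 4 := by ring

/-- `n^{1/4} < dq n + 1`. [cite: CoppersmithRivlin1992, Thm. (p. 970); elementary] -/
theorem rpow_quarter_lt_dq_succ (n : ℕ) : (n : ℝ) ^ (1 / 4 : ℝ) < (dq n : ℝ) + 1 := by
  have h := lt_dq_succ_pow_four n
  have h' : (n : ℝ) < ((dq n : ℝ) + 1) ^ 4 := by exact_mod_cast h
  have hpos : (0 : ℝ) ≤ (dq n : ℝ) + 1 := by positivity
  calc (n : ℝ) ^ (1 / 4 : ℝ) < (((dq n : ℝ) + 1) ^ 4) ^ (1 / 4 : ℝ) :=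
        rpow_lt_rpow (Nat.cast_nonneg n) h' (by norm_num)
    _ = (dq n : ℝ) + 1 := by
        rw [show (1 / 4 : ℝ) = ((4 : ℕ) : ℝ)⁻¹ by norm_num]
        exact pow_rpow_inv_natCast hpos four_ne_zero

/-- `x ≤ n^{1/4}` from `x⁴ ≤ n` (`x ≥ 0`). [cite: CoppersmithRivlin1992, Thm. (p. 970); elementary] -/
theorem le_rpow_quarter {x : ℝ} (hx : 0 ≤ x) {n : ℕ} (h : x ^ 4 ≤ (n : ℝ)) : x ≤ (n : ℝ) ^ (1 / 4 : ℝ) := by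
  calc x = (x ^ 4) ^ (1 / 4 : ℝ) := by
        rw [show (1 / 4 : ℝ) = ((4 : ℕ) : ℝ)⁻¹ by norm_num]
        exact (pow_rpow_inv_natCast hx four_ne_zero).symm
    _ ≤ (n : ℝ) ^ (1 / 4 : ℝ) := rpow_le_rpow (by positivity) h (by norm_num)

/-- **The arithmetic**: for `r ≥ 1`, `r < exp(c q)` with `c = a/(8(p+2))`, `q = n^{1/4} ≥ 6/a`,
`q/2 ≤ D`, `1 ≤ log n`: both `2 log r + log n < a D log n` and `p log r + 2 log n < a D log n`.
[cite: Rothvoss2017, §2 (PDF pp. 6–8); elementary] -/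
theorem key_arith {a q D L lr : ℝ} {p : ℕ} (ha : 0 < a) (hq : 6 / a ≤ q) (hD : q / 2 ≤ D)
    (hL : 1 ≤ L) (hlr0 : 0 ≤ lr) (hlr : lr < a / (8 * ((p : ℝ) + 2)) * q) :
    2 * lr + L < a * D * L ∧ (p : ℝ) * lr + 2 * L < a * D * L := by
  have hp0 : (0 : ℝ) ≤ p := Nat.cast_nonneg p
  have hq0 : 0 < q := lt_of_lt_of_le (by positivity) hq
  have haq : 6 ≤ a * q := by
    have := mul_le_mul_of_nonneg_left hq ha.le
    rwa [mul_div_cancel₀ _ ha.ne'] at this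
  -- `(p + 2) · lr < a q / 8`
  have h1 : ((p : ℝ) + 2) * lr < a * q / 8 := by
    have := mul_lt_mul_of_pos_left hlr (by positivity : (0 : ℝ) < (p : ℝ) + 2)
    calc ((p : ℝ) + 2) * lr < ((p : ℝ) + 2) * (a / (8 * ((p : ℝ) + 2)) * q) := this
      _ = a * q / 8 := by field_simp
  have h2 : 2 * lr ≤ ((p : ℝ) + 2) * lr := by nlinarith
  have h3 : (p : ℝ) * lr ≤ ((p : ℝ) + 2) * lr := by nlinarith
  have h4 : a * q / 8 ≤ a * q / 8 * L := le_mul_of_one_le_right (by positivity) hL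
  have h5 : a * q / 2 * L ≤ a * D * L := by nlinarith
  constructor <;> nlinarith

end ChebyshevTracialDesignAssembly

open ChebyshevTracialDesignAssembly
open Summit.PneNP.PneNP.Theses.ChebyshevTracialDesign

/-- **Item `StretchedExpAssembly` of route `ChebyshevTracialDesign`**: the tracial hyperplane bound,
dimension-restricted tracial decay of balanced Chebyshev designs (`TracialDecay20`) and the design
existence (`ChebyshevDesign20`) give the rung leaf `Target` (= `MatchingPsdRankStretchedExp`): no psd
factorization of the odd-cut slack matrix of `P_PM(K_n)` of size `r < exp(c·n^{1/4})`.
[cite: Rothvoss2017, §2 (PDF pp. 6–8)] -/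
theorem StretchedExpAssembly_proof :
    Summit.PneNP.PneNP.Theses.ChebyshevTracialDesign.StretchedExpAssembly := by
  intro hT h2 h3
  obtain ⟨p, hp⟩ := hT
  obtain ⟨a₀, ha₀, hB⟩ := h2
  obtain ⟨a, ha, n₀, hmult⟩ := expTracialBoundDim_of_bal 20 a₀ ha₀ h3 hB
  refine ⟨1 / 4, by norm_num, a / (8 * ((p : ℝ) + 2)), by positivity,
    max n₀ (max 16 ⌈(6 / a) ^ 4⌉₊), fun n hn hev r hr hfac => ?_⟩
  have hn₀ : n₀ ≤ n := le_trans (le_max_left _ _) hn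
  have hn16 : 16 ≤ n := le_trans (le_max_left _ _) (le_trans (le_max_right _ _) hn)
  have hnceil : ⌈(6 / a) ^ 4⌉₊ ≤ n := le_trans (le_max_right _ _) (le_trans (le_max_right _ _) hn)
  have hnpos : (0 : ℝ) < n := by exact_mod_cast (by omega : 0 < n)
  obtain ⟨t, C, w, hne, hnorm, hval⟩ := hmult n hn₀ hev
  -- the double count
  have hdc : ∑ U, ∑ M, levelWeight n t C w U M * pmOddCutSlack n U M = 1 := by
    rw [sum_levelWeight_mul_slack hne, hnorm]
  rcases Nat.eq_zero_or_pos r with rfl | hr0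
  · -- `r = 0`: the slack matrix would vanish
    obtain ⟨A, B, -, -, hS⟩ := hfac
    have h0 : ∀ U M, pmOddCutSlack n U M = 0 := fun U M => by
      rw [hS U M]; simp [Matrix.trace]
    simp only [h0, mul_zero, sum_const_zero] at hdc
    exact zero_ne_one hdc
  · -- `r ≥ 1`: hyperplane bound versus arithmetic
    set q : ℝ := (n : ℝ) ^ (1 / 4 : ℝ) with hq
    set D : ℝ := (dq n : ℝ) with hD
    set L : ℝ := Real.log n with hL
    have hr0' : (0 : ℝ) < r := by exact_mod_cast hr0
    have hlr0 : 0 ≤ Real.log r := Real.log_nonneg (by exact_mod_cast hr0)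
    have hlr : Real.log r < a / (8 * ((p : ℝ) + 2)) * q := (log_lt_iff_lt_exp hr0').2 hr
    have hq2 : 2 ≤ q := le_rpow_quarter (by norm_num) (by norm_num; exact_mod_cast hn16)
    have hq6 : 6 / a ≤ q :=
      le_rpow_quarter (by positivity) (le_trans (Nat.le_ceil _) (by exact_mod_cast hnceil))
    have hDq : q / 2 ≤ D := by
      have := rpow_quarter_lt_dq_succ n
      rw [← hq, ← hD] at this
      linarith
    have hL1 : 1 ≤ L := by
      rw [hL, le_log_iff_exp_le hnpos]
      have := Real.exp_one_lt_d9
      have h16 : (16 : ℝ) ≤ n := by exact_mod_cast hn16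
      linarith
    obtain ⟨hA1, hA2⟩ := key_arith (p := p) ha hq6 hDq hL1 hlr0 hlr
    -- (1) `r² n < n^{a D}`: the dimension restriction
    have h1 : (r : ℝ) ^ 2 * n < (n : ℝ) ^ (a * (dq n : ℝ)) := by
      rw [lt_rpow_iff_log_lt (by positivity) hnpos, Real.log_mul (by positivity) hnpos.ne',
        Real.log_pow, Nat.cast_ofNat]
      rw [← hD, ← hL]; linarith
    have hW := hval r hr0 h1
    -- the hyperplane bound with `Δ = n²`
    have hbound := hp n r (pmOddCutSlack n) (levelWeight n t C w) ((n : ℝ) ^ 2)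
      ((n : ℝ) ^ (-(a * (dq n : ℝ)))) (by positivity) (fun U M => cc_sub_one_le U M)
      (fun U M h1' => by simp [pmOddCutSlack, h1']) hW hfac
    rw [hdc] at hbound
    -- (2) `r^p n² n^{-a D} < 1`
    have h2 : (r : ℝ) ^ p * (n : ℝ) ^ 2 < (n : ℝ) ^ (a * (dq n : ℝ)) := by
      rw [lt_rpow_iff_log_lt (by positivity) hnpos, Real.log_mul (by positivity) (by positivity),
        Real.log_pow, Real.log_pow, Nat.cast_ofNat]
      rw [← hD, ← hL]; linarith
    have hpow : (0 : ℝ) < (n : ℝ) ^ (a * (dq n : ℝ)) := rpow_pos_of_pos hnpos _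
    have h3' : (r : ℝ) ^ p * (n : ℝ) ^ 2 * (n : ℝ) ^ (-(a * (dq n : ℝ))) < 1 := by
      rw [rpow_neg hnpos.le, ← div_eq_mul_inv, div_lt_one hpow]
      exact h2
    linarith

end Summit.PneNP.PneNP.Theorems
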